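import Summits.BirchSwinnertonDyer.BirchSwinnertonDyer.Theorems.ByReductionTypeAtTwoSupersingularHondaSystemAtTwoExists
import Summits.BirchSwinnertonDyer.BirchSwinnertonDyer.Theorems.ByReductionTypeAtTwoSupersingularFlatLocalDataOfHondaSystem
import HarnessLib

/-!
# Route `ByReductionTypeAtTwo` (rung K4), crux `SupersingularRankZeroAtTwo` (item stmt-BirchSwinnertonDyer-19097), line `odd_blind_package`
# v2.16 (registry sha256 `894e1c8537f556ac…`, commit c58af0388707): **stub 2/6 `stub_hondaAtTwo` DISCHARGED BY NAME** by tower-1 GEN 66's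
# unconditional kernel theorem `SSHondaTwo.hondaSystemAtTwoExists : F1Sign2.HondaSystemAtTwoExists` (Sprung 2012 Thm. 2.2 AT `p = 2`, all
# `a₂ ∈ {0, ±2}`), and the old stub 2's local conjuncts (1)–(6) made UNCONDITIONAL (★ p827135 ∘ (C1))

HONEST FRAMING (cell `bsd-2adic`, run/shared/lean/pub/bsd-2adic/, seat `bsd-2adic-ss-1` GEN 24 = LEAD lineage of 19097; HUMAN RULINGS
D-0036 / D-0054 / D-0074; director-bsd (867)(b)(i) / (869)(a)): THEOREMS ONLY (no definition, no named fact, no instance, no `sorry`, axioms the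
standard trio).  `stub_hondaAtTwo` below has EXACTLY the registered name and signature (`Lines/odd_blind_package.lean` v2.16 :1739–1740:
`theorem stub_hondaAtTwo : Summit.BirchSwinnertonDyer.Rank1Residual.F1Sign2.HondaSystemAtTwoExists`) and is proved by the landed theorem, so ONE of the
six registered stubs of 19097 is a tree theorem; the crux stays OPEN on the other five (`stub_pub` [print], `stub_flatPackage` ⟸ {COUNT♭, F1♭, ZL2},
`stub_fineMu`, `stub_oddFlatValueLaw`, `stub_lowerOffGenericOdd`); nothing booked; BSD is proved for no curve by this file.

WHAT.  (C1) = `F1Sign2.HondaSystemAtTwoExists` (cell `bsd-f1-sign2`'s def, `Summits/BirchSwinnertonDyer/Rank1Residual/F1Sign2/LocalConditionAtTwo.lean`):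
on every globally minimal `W/ℚ` good supersingular at `2`, along the local cyclotomic `ℤ₂`-tower at the place above `2`, a NEGATIVE-SIGN local
system `(g, cneg, c)` with Sprung's `p = 2` relations (`IsHondaSystemAtTwo`).  Tower-1 GEN 66 proved it in the kernel for all `a₂ ∈ {0, ±2}`
(files `…HondaSystemAtTwo{Dual,PrimalZero,Zero,SprungIso,SprungGenStep,SprungPoints,SprungPrimal,Exists}.lean`).  This file: (i) the registered
stub by name; (ii) `flatLocalData_two` = ★ p827135 `SSFlatLocalData.flatLocalData_of_hondaSystemAtTwoExists` at (C1): conjuncts (1)–(6) of the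
old stub 2 `UniformFlatHondaDataAtTwo` (local system, (Tr), (INJ), (SAT), Honda legality) now UNCONDITIONAL; (iii) a read-back `example`.

References: F. Sprung, J. Number Theory 132 (2012) 1483–1506, Thm. 2.2, Def. 2.7, Lemma 7.9; S. Kobayashi, Invent. Math. 152 (2003), §8.
-/

set_option autoImplicit false
-- the Theorems namespace of this sub repeats the summit name by design (D-0017 nested layout: Summit.<S>.<Sub>)
set_option linter.dupNamespace false

noncomputable section

open scoped Classical NumberField

namespace Summit.BirchSwinnertonDyer.BirchSwinnertonDyer.Theorems.OddBlindStubs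

open NumberField IsDedekindDomain WeierstrassCurve Literature.NumberTheory.EllipticCurves
  Literature.NumberTheory.EllipticCurves.ZpExtension Literature.NumberTheory.EllipticCurves.Sprung2012
  Literature.NumberTheory.EllipticCurves.Kobayashi2003 Literature.NumberTheory.GaloisRepresentations
  Literature.NumberTheory.EllipticCurves.Rank1Residual
  Summit.BirchSwinnertonDyer.Rank1Residual Summit.BirchSwinnertonDyer.Rank1Residual.F1Sign2

/-- ★★★ **Registered stub 2/6 of crux 19097 (line `odd_blind_package` v2.16), BY NAME: `stub_hondaAtTwo`** — (C1) Sprung 2012 Thm. 2.2 at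
`p = 2` in `ℤ₂`-tower form, `F1Sign2.HondaSystemAtTwoExists`, for every globally minimal good-supersingular-at-`2` curve (`a₂ ∈ {0, ±2}`).
Proof: tower-1 GEN 66's unconditional kernel theorem `SSHondaTwo.hondaSystemAtTwoExists`.  Same name and signature as the registered stub
(`Lines/odd_blind_package.lean` :1739). [cite: Sprung2012, Thm. 2.2 (p. 1487), Def. 2.7, Lemma 7.9] -/
theorem stub_hondaAtTwo : Summit.BirchSwinnertonDyer.Rank1Residual.F1Sign2.HondaSystemAtTwoExists :=
  SSHondaTwo.hondaSystemAtTwoExists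

/-- ★★ **Conjuncts (1)–(6) of the old stub 2 `UniformFlatHondaDataAtTwo`, UNCONDITIONAL**: on every curve of the crux (non-CM, analytic rank `0`,
good supersingular at `2`), every cyclotomic `(κ, γ)`, at the place `v ∋ 2`: a local system `(g, c)` with `g` restricting to a topological
generator, `c n ∈ E(ℚ_{n,v})`, Sprung's trace relation `Tr_{n+1/n} c_{n+1} = a₂ c_n − c_{n−1}` (`n ≥ 1`), the layer-`0` conditions (INJ)
(`z₀(c 0) = 0 ⇒ z₀ = 0`) and (SAT) (`2a` a value at `c 0` ⇒ `a` a value), and the Honda legality `∃ cneg, IsHondaSystemAtTwo κ ι W a₂ g cneg c` —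
★ p827135 `SSFlatLocalData.flatLocalData_of_hondaSystemAtTwoExists` (its conclusion VERBATIM) evaluated at (C1).
[cite: Sprung2012, Thm. 2.2, Lemma 7.9] -/
theorem flatLocalData_two :
    ∀ (W : WeierstrassCurve ℚ) [W.IsElliptic] [W.IsGloballyMinimal],
      ¬ W.HasCM → W.analyticRank = 0 → GoodSS W 2 →
      ∀ (κ : ZpExtension ℚ 2) (γ : Field.absoluteGaloisGroup ℚ),
        κ.IsCyclotomic → κ.IsTopGenerator γ → IsCyclotomicVariable 2 γ →
      ∀ (v : HeightOneSpectrum (𝓞 ℚ)), (2 : 𝓞 ℚ) ∈ v.asIdeal →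
      ∃ (g : Field.absoluteGaloisGroup (v.adicCompletion ℚ)) (c : ℕ → localPoints W (v.adicCompletion ℚ)),
        κ.IsTopGenerator (resGalOfEmb (closureEmb (K := ℚ) (v.adicCompletion ℚ)) g) ∧
        (∀ n, c n ∈ localLayerPointsOfEmb κ (closureEmb (K := ℚ) (v.adicCompletion ℚ)) W n) ∧
        (∀ n, 1 ≤ n → localTraceOfEmb κ (closureEmb (K := ℚ) (v.adicCompletion ℚ)) W n (n + 1)
          (c (n + 1)) = W.frobeniusTrace 2 • c n - c (n - 1)) ∧
        (∀ z₀ : localLayerPointsOfEmb κ (closureEmb (K := ℚ) (v.adicCompletion ℚ)) W 0 →+ ℤ_[2],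
          evalOn W (localLayerPointsOfEmb κ (closureEmb (K := ℚ) (v.adicCompletion ℚ)) W 0) z₀ (c 0) = 0 →
            z₀ = 0) ∧
        (∀ a : ℤ_[2],
          (∃ z₀ : localLayerPointsOfEmb κ (closureEmb (K := ℚ) (v.adicCompletion ℚ)) W 0 →+ ℤ_[2],
            evalOn W (localLayerPointsOfEmb κ (closureEmb (K := ℚ) (v.adicCompletion ℚ)) W 0) z₀ (c 0) =
              2 * a) →
          ∃ y : localLayerPointsOfEmb κ (closureEmb (K := ℚ) (v.adicCompletion ℚ)) W 0 →+ ℤ_[2],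
            evalOn W (localLayerPointsOfEmb κ (closureEmb (K := ℚ) (v.adicCompletion ℚ)) W 0) y (c 0) = a) ∧
        (∃ cneg : localPoints W (v.adicCompletion ℚ),
          IsHondaSystemAtTwo κ (closureEmb (K := ℚ) (v.adicCompletion ℚ)) W (W.frobeniusTrace 2) g cneg c) :=
  SSFlatLocalData.flatLocalData_of_hondaSystemAtTwoExists SSHondaTwo.hondaSystemAtTwoExists

/-- Read-back (pen shape): the registered signature of `stub_hondaAtTwo`, closed by the theorem of the same name. -/
example : Summit.BirchSwinnertonDyer.Rank1Residual.F1Sign2.HondaSystemAtTwoExists := stub_hondaAtTwo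

end Summit.BirchSwinnertonDyer.BirchSwinnertonDyer.Theorems.OddBlindStubs

end
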